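import Mathlib

/-!
# SoloBlind — centre-preconditioned Neumann fixed point (ENGINE L⁺, PLAN §121.6–121.15)

On the top sliver of regime (II) the absolute weighted gain of the loop matrix `L` of LEMMA P is
close to or above `1` (Perron root of `|L|` reaches `1.05` at the strip bottom near the pair at
`P_R`), so a plain weighted Neumann argument does not apply there.  ENGINE L⁺ instead inverts
`1 - L_c` at the box centre (a dense interval matrix `M`, with `M * (1 - L_c) = 1`) and only has
to contract the *variation* `E = M * (L - L_c)` over the box, whose weighted gain `θ` is small.
This file is self-contained (the weighted-maximum argument is carried out inline):

* `precond_one_sub` : `M * (1 - L_c) = 1 → M * (1 - L) = 1 - M * (L - L_c)`;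
* `fixedPoint_precond` : a solution of `s = s₀ + L s` solves `s = M s₀ + E s`;
* `fixedPoint_precond_bound` : with positive weights `w` and the weighted Schur test for `E` at
  level `θ < 1`, every solution of `s = s₀ + L s` with `‖(M s₀) j‖ ≤ B w j` satisfies
  `‖s m‖ ≤ B/(1-θ) · w m` and `‖s m - (M s₀) m‖ ≤ θ B/(1-θ) · w m` — the full-model column is the
  explicit centre-preconditioned value `M s₀` up to a certified small envelope;
* `fixedPoint_precond_existsUnique` : under the same hypotheses `s = s₀ + L s` has exactly one
  solution (so `1 - L` is invertible although `|L|` itself need not contract).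
-/

namespace Summit.AnomalousDissipation.SoloBlind.PrecondNeumann

open Finset Matrix

variable {n : ℕ} {L Lc M : Matrix (Fin n) (Fin n) ℂ} {w : Fin n → ℝ} {θ : ℝ}

/-- Preconditioning identity: if `M` inverts `1 - L_c` then `M (1 - L) = 1 - M (L - L_c)`. -/
theorem precond_one_sub (hM : M * (1 - Lc) = 1) : M * (1 - L) = 1 - M * (L - Lc) := by
  have h1 : M * (1 - L) = M * (1 - Lc) - M * (L - Lc) := by
    rw [← Matrix.mul_sub]; congr 1; abel
  rw [h1, hM]

/-- A solution of `s = s₀ + L s` solves the preconditioned equation `s = M s₀ + (M (L - L_c)) s`. -/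
theorem fixedPoint_precond (hM : M * (1 - Lc) = 1) {s s₀ : Fin n → ℂ} (hs : s = s₀ + L *ᵥ s) :
    s = M *ᵥ s₀ + (M * (L - Lc)) *ᵥ s := by
  have h0 : (1 - L) *ᵥ s = s₀ := by
    rw [sub_mulVec, one_mulVec]
    exact sub_eq_of_eq_add hs
  have h2 : (M * (1 - L)) *ᵥ s = M *ᵥ s₀ := by rw [← mulVec_mulVec, h0]
  rw [precond_one_sub hM, sub_mulVec, one_mulVec] at h2
  exact eq_add_of_sub_eq h2

/-- ENGINE L⁺ bound: with `θ < 1` the weighted gain of `E = M (L - L_c)`, every solution of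
`s = s₀ + L s` lies within `θ B/(1-θ) · w` of the explicit preconditioned value `M s₀`. -/
theorem fixedPoint_precond_bound (hw : ∀ m, 0 < w m) (hθ : θ < 1)
    (hrow : ∀ m, ∑ j, ‖(M * (L - Lc)) m j‖ * w j ≤ θ * w m) (hM : M * (1 - Lc) = 1)
    {s s₀ : Fin n → ℂ} (hs : s = s₀ + L *ᵥ s) {B : ℝ} (hB : ∀ j, ‖(M *ᵥ s₀) j‖ ≤ B * w j) :
    (∀ m, ‖s m‖ ≤ B / (1 - θ) * w m) ∧ (∀ m, ‖s m - (M *ᵥ s₀) m‖ ≤ θ * B / (1 - θ) * w m) := by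
  have hs' := fixedPoint_precond hM hs
  set E := M * (L - Lc) with hE
  set t₀ := M *ᵥ s₀ with ht₀
  -- weighted Schur step for `E`
  have schur : ∀ {v : Fin n → ℂ} {C : ℝ}, (∀ j, ‖v j‖ ≤ C * w j) → 0 ≤ C →
      ∀ m, ‖(E *ᵥ v) m‖ ≤ θ * C * w m := by
    intro v C hv hC m
    calc ‖(E *ᵥ v) m‖ = ‖∑ j, E m j * v j‖ := rfl
      _ ≤ ∑ j, ‖E m j * v j‖ := norm_sum_le _ _
      _ ≤ ∑ j, ‖E m j‖ * (C * w j) := by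
          refine sum_le_sum fun j _ => ?_
          rw [norm_mul]; exact mul_le_mul_of_nonneg_left (hv j) (norm_nonneg _)
      _ = C * ∑ j, ‖E m j‖ * w j := by rw [mul_sum]; refine sum_congr rfl fun j _ => by ring
      _ ≤ C * (θ * w m) := mul_le_mul_of_nonneg_left (hrow m) hC
      _ = θ * C * w m := by ring
  rcases Nat.eq_zero_or_pos n with hn | hn
  · subst hn; exact ⟨fun m => m.elim0, fun m => m.elim0⟩
  -- the weighted maximum of `‖s ·‖ / w ·`
  have hne : (univ : Finset (Fin n)).Nonempty := ⟨⟨0, hn⟩, mem_univ _⟩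
  obtain ⟨m₀, -, hmax⟩ := exists_max_image univ (fun m => ‖s m‖ / w m) hne
  set C := ‖s m₀‖ / w m₀ with hC
  have hC0 : 0 ≤ C := div_nonneg (norm_nonneg _) (hw m₀).le
  have hsC : ∀ j, ‖s j‖ ≤ C * w j := fun j => (div_le_iff₀ (hw j)).mp (hmax j (mem_univ j))
  have hEs : ∀ m, ‖(E *ᵥ s) m‖ ≤ θ * C * w m := schur hsC hC0
  -- the key inequality at the maximiser: C w ≤ B w + θ C w
  have hkey : C * w m₀ ≤ B * w m₀ + θ * C * w m₀ := by
    have h1 : ‖s m₀‖ = C * w m₀ := by rw [hC, div_mul_cancel₀ _ (hw m₀).ne']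
    have h2 : ‖s m₀‖ ≤ ‖t₀ m₀‖ + ‖(E *ᵥ s) m₀‖ := by
      have h3 := congrArg (fun f => f m₀) hs'
      simp only [Pi.add_apply] at h3
      rw [h3]; exact norm_add_le _ _
    linarith [hB m₀, hEs m₀]
  have hCle : C ≤ B / (1 - θ) := by
    rw [le_div_iff₀ (by linarith)]
    nlinarith [hw m₀]
  refine ⟨fun m => (hsC m).trans (mul_le_mul_of_nonneg_right hCle (hw m).le), fun m => ?_⟩
  have hdiff : s m - t₀ m = (E *ᵥ s) m := by
    have h3 := congrArg (fun f => f m) hs'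
    simp only [Pi.add_apply] at h3
    rw [h3]; ring
  rw [hdiff]
  refine (hEs m).trans ?_
  have hθ0 : 0 ≤ θ := by
    have h0 : 0 ≤ ∑ j, ‖E m₀ j‖ * w j :=
      sum_nonneg fun j _ => mul_nonneg (norm_nonneg _) (hw j).le
    have h4 := hrow m₀
    nlinarith [hw m₀]
  have h5 : θ * C ≤ θ * B / (1 - θ) := by
    rw [mul_div_assoc]; exact mul_le_mul_of_nonneg_left hCle hθ0
  exact mul_le_mul_of_nonneg_right h5 (hw m).le

/-- Under the ENGINE L⁺ hypotheses the column equation `s = s₀ + L s` has exactly one solution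
(invertibility of `1 - L` follows from the a priori bound with `s₀ = 0`). -/
theorem fixedPoint_precond_existsUnique (hw : ∀ m, 0 < w m) (hθ : θ < 1)
    (hrow : ∀ m, ∑ j, ‖(M * (L - Lc)) m j‖ * w j ≤ θ * w m) (hM : M * (1 - Lc) = 1)
    (s₀ : Fin n → ℂ) : ∃! s : Fin n → ℂ, s = s₀ + L *ᵥ s := by
  -- homogeneous solutions vanish
  have key : ∀ v : Fin n → ℂ, v = L *ᵥ v → v = 0 := fun v hv => by
    have h := (fixedPoint_precond_bound hw hθ hrow hM (s₀ := 0) (s := v) (by simpa using hv)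
      (B := 0) (fun j => by simp)).1
    funext m
    have h1 := h m
    simp only [zero_div, zero_mul, norm_le_zero_iff] at h1
    simpa using h1
  have hL : IsUnit (1 - L) := by
    rw [← mulVec_injective_iff_isUnit]
    intro u v huv
    have h : u - v = L *ᵥ (u - v) := by
      have h1 : u - L *ᵥ u = v - L *ᵥ v := by
        simpa only [sub_mulVec, one_mulVec] using huv
      rw [mulVec_sub]
      linear_combination h1
    exact sub_eq_zero.mp (key _ h)
  obtain ⟨s, hs⟩ := (mulVec_surjective_iff_isUnit.mpr hL) s₀
  have hs' : s = s₀ + L *ᵥ s := by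
    simp only [sub_mulVec, one_mulVec] at hs
    rw [← hs]; abel
  refine ⟨s, hs', fun t ht => ?_⟩
  have ht' : t = s₀ + L *ᵥ t := ht
  have h : t - s = L *ᵥ (t - s) := by
    rw [mulVec_sub]
    linear_combination ht' - hs'
  exact sub_eq_zero.mp (key _ h)

end Summit.AnomalousDissipation.SoloBlind.PrecondNeumann
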